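import Mathlib
import HarnessLib
import Summits.HubbardSuperconductivity.HubbardSuperconductivity.Theorems.KLProgrammeKLRegimeEngineTowerPartialIncrLevStepFOne
import Summits.HubbardSuperconductivity.HubbardSuperconductivity.Theorems.KLProgrammeKLRegimeEngineTowerBlockZeroLinkDataFKlEng

/-!
# Route `KLProgramme` — crux K3 ENGINE (stmt-HubbardSuperconductivity-20437 `KLRegimeEngineV17F2`), stub (b) v2, THE LEVELS PACKAGE (ℓ), located item
# «(ℓ)-READOUT-F», (R332)(D)(α′) RO-3′: THE BLOCK-`0` KIT STEP ON THE FLOW FRAME `K_n`, DATA DISCHARGED — the floor-keyed levelled step of the thick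
# block `𝒱_j − 𝒱_1`, `1 ≤ j ≤ d`, off the LEVEL-`0` datum `𝒱_1 @ F̃_0` (cell gate-hubbard-kl, seat gate-hubbard-kl-p3 g22; the `d·k = 1` twin of
# k3c2-p3 g14 / k3c3-p2 g16's `partialIncrLevF_le_kitStep_klEng'` (…TowerPartialIncrLevStepFKlEng §3): `partialIncrLevF_le_kitStep_of_bounds'`
# (…TowerPartialIncrLevStepFOne) at `(d, k) := (1, 1)` ∘ p3 g21's `linkDataBlockZeroF_klEng` (…TowerBlockZeroLinkDataFKlEng))

WHY.  The levels `1 ≤ j < d` of stub (b)'s `KernelNormsLevels … (K_n) j` lie in block `0` of the re-based tower, which the law never enters (its first input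
is `𝒱_d`).  (α′) reads them as `𝒱_j = 𝒱_1 + (𝒱_j − 𝒱_1)`: the level-`0` datum `𝒱_1[K_n]` measured at `F_0` (arrays `klTowerMeasLev … 1 1`, floor array
`klTowerMuLevF … 1 1 m` at `J = 0`; the F7 / `…srcWindow_zero` class, grid rows = klE4X0) plus ONE Gaussian step of the thick slice `(Λ_j, Λ_1]` sandwiched
by `S(F̃_0)`.  The eight data of that step on `K_n` are `linkDataBlockZeroF_klEng (d R c″)` (Gram `κ₀`, `κ₀²·8 ≤ (√(2Cκe₀))²`, UNWEIGHTED rows/cols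
`≤ Cb·(M/β)/Λ_j ≤ (Cb·(M/β)·4^d/e₀)·4`, analysis overlap of `E(F_j)·S(F̃_0)` `≤ 81·CJ·M/β`, `≤ 162·CJ·M/β` — used here at the born family `j := 1`), and
the model half is `partialIncrLevF_le_kitStep_of_bounds'` at `(d, k) := (1, 1)` (`klTowerInput … 1 1 = 𝒱_1`, `bgmFatMultiplier … (1·1 − 1) = F̃_0`,
`klLevUnitF … (1·1)`; the products `1·1` are closed numerals, definitionally `1`).

* **`blockZeroIncrLevF_le_kitStep_klEng (d R c″)`** — `∃ Cκ Cb CJ > 0`, under `linkDataBlockZeroF_klEng`'s door prefix verbatim: for every `1 ≤ j ≤ d`,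
  `j ≤ n`, given `Z^{K_n}_{Λ_1} ≠ 0`, a degree cap `D` at `SpaceTimeIdx × SectorLeg (sectorCount 0)`, the four constants pinned by the SAME equations as
  `partialIncrLevF_le_kitStep_klEng'` (`κ̄ = √(2Cκe₀)`, `ᾱ = Cb·(M/β)·4^d/e₀`, `c̄r = 81·CJ·M/β`, `c̄c = 162·CJ·M/β`) and the kit guard: for every track `t`,
  degree `2(q+1)` and prescription `Ωe` of level `t+1` at `F_1`, `klLevNormOf … 1 (2(q+1)) (𝒱_j − 𝒱_1) Ωe / klLevUnitF β M t (q+1) 1 ≤` the kit's literal step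
  at `W̄·Z̄^m·klTowerMuLevF … (K_n) 1 1 m` with `σ̄ τ̄ ψ̄ Φ̄` — the tail of `partialIncrLevF_le_kitStep_klEng'` verbatim at `(d, k) := (1, 1)`.
Compositions of landed theorems; nothing about the model is asserted beyond them; nothing asserts (ℓ), any stub, K3 or superconductivity.
References: BGM 2006 §2.7 (2.71a), §2.8 (2.76)–(2.84), (2.97)–(2.98), §3 (3.2)–(3.8) [cite: BenfattoGiulianiMastropietro2006].
-/

noncomputable section

namespace Summit.HubbardSuperconductivity.HubbardSuperconductivity.Theorems.EngineV8

set_option linter.dupNamespace false -- summit = problem name (single-conjunct summit), D-0017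

open Classical
open Real Finset Literature.MathematicalPhysics.QuantumLattice Literature.Probability.LatticeModels GrassmannAlgebra
open Literature.MathematicalPhysics.QuantumLattice.FermiRG Literature.MathematicalPhysics.QuantumLattice.FermiRG.BGM2006Routing
open Summit.HubbardSuperconductivity.HubbardSuperconductivity.Theorems.KLProgrammeLegKernels
open Summit.HubbardSuperconductivity.HubbardSuperconductivity.Theorems.KLRegimeSplit
open Summit.HubbardSuperconductivity.HubbardSuperconductivity.Theorems.KLRegimeWick
open Summit.HubbardSuperconductivity.HubbardSuperconductivity.Theorems.TwoPointAssembly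
open Summit.HubbardSuperconductivity.HubbardSuperconductivity.Theorems.DispersionFlow
open Summit.HubbardSuperconductivity.HubbardSuperconductivity.Theorems.TorusFourierL2

variable {L M : ℕ} [NeZero L] [NeZero M]

/-! ## The block-`0` kit step on the flow frame -/

/-- **THE BLOCK-`0` KIT STEP ON THE FLOW FRAME `K_n`, DATA DISCHARGED** ((α′) RO-3′): under `linkDataBlockZeroF_klEng`'s door prefix, for every `j` with
`1 ≤ j ≤ d`, `j ≤ n`, given `Z^{K_n}_{Λ_1} ≠ 0`, a degree cap `D` at the input label set `SpaceTimeIdx × SectorLeg (sectorCount 0)`, the four constants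
pinned by equations (`κ̄ = √(2Cκe₀)`, `ᾱ = Cb·(M/β)·4^d/e₀`, `c̄r = 81·CJ·M/β`, `c̄c = 162·CJ·M/β` — the SAME shape as `partialIncrLevF_le_kitStep_klEng'`) and
the kit guard at the level-`0` floor array `W̄·Z̄^m·klTowerMuLevF … (K_n) 1 1 m` (`𝒱_1[K_n]` measured at `F_0`, floor units at `J = 0`): for every track `t`,
degree `2(q+1)` and prescription `Ωe` of level `t + 1` at the born family `F_1`, the floor norm of the thick-block increment `𝒱_j − 𝒱_1` obeys the kit's
literal step — `partialIncrLevF_le_kitStep_of_bounds'` at `(d, k) := (1, 1)` ∘ `linkDataBlockZeroF_klEng`.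
[cite: BenfattoGiulianiMastropietro2006, §2.7 (2.71a), §2.8 (2.76)-(2.84), (2.97)-(2.98), §3 (3.2)-(3.8)] -/
theorem blockZeroIncrLevF_le_kitStep_klEng (d : ℕ) (R : RenConsts) (c'' : ℝ) (hc'' : 0 < c'') :
    ∃ Cκ Cb CJ : ℝ, 0 < Cκ ∧ 0 < Cb ∧ 0 < CJ ∧
      ∀ (G : GeoConsts) (P : SplitConsts) (Q : EngConsts) (c : ℝ), P.WF → R.WF2 → 0 < c → c ≤ klEngC₃6 P R →
      ∀ μ ∈ klWindowC, ∀ U : ℝ, 0 < U → U ≤ klEngU₀9 P R c → c'' * U ≤ 1 →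
      ∀ β : ℝ, klBetaMin ≤ β → β ≤ Real.exp (c / U ^ 2) →
      ∀ (L M : ℕ) [NeZero L] [NeZero M], klEngL₃ β U ≤ L → klEngM₃ β U L ≤ M →
      ∀ n : ℕ, 1 ≤ n → n ≤ nScales β + 1 → IsKLRegime U c (-(n : ℤ)) →
        HistP klPredsV17F2 L M G P Q R β U μ 0 n → FrameOK R U (nScales β) μ (klFlowFrameU L M β U μ n) →
        (∀ m, 1 ≤ m → m < n → FlowPieceOscAt L M c'' β U μ m) →
      ∀ j : ℕ, 1 ≤ j → j ≤ d → j ≤ n →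
        hubbardEffPartitionFnCT L M β U μ 0 (klFlowFrameU L M β U μ n) (klScale klE0 1) ≠ 0 →
      ∀ D : ℕ, Fintype.card (SpaceTimeIdx L M × SectorLeg (sectorCount 0)) / 2 ≤ D →
      ∀ κb αb crb ccb : ℝ, κb = Real.sqrt (2 * Cκ * klE0) → αb = Cb * ((M : ℝ) / β) * (4 : ℝ) ^ d / klE0 →
        crb = 81 * CJ * M / β → ccb = 162 * CJ * M / β →
      ∀ N : ℕ, 1 ≤ N →
        9 * αb * ccb / ((27 : ℝ) ^ 5 * exp 1 * κb ^ 2 * crb) *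
      towerV D (exp 2 * κb ^ 2 / ccb ^ 2)
        (fun m => 64 * (27 : ℝ) ^ 4 * exp 2 * crb / ccb * (exp 4 * ccb ^ 2 * imagTimeWeight β M ^ 2 / 8) ^ m *
          klTowerMuLevF L M β U μ (klFlowFrameU L M β U μ n) 1 1 m) < 1 →
      ∀ (t : Fin 5) (q : ℕ) (Ωe : Fin (2 * q + 1 + 1) → Option (SectorLeg (sectorCount 1))), levelCount Ωe = (t : ℕ) + 1 →
    klLevNormOf L M β μ (klFlowFrameU L M β U μ n) 1 (2 * q + 1 + 1) (klEffectiveAction L M β U μ (klFlowFrameU L M β U μ n) klE0 j -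
          klTowerInput L M β U μ (klFlowFrameU L M β U μ n) 1 1) Ωe /
        klLevUnitF β M t (q + 1) 1 ≤
      towerFO D (κb ^ 2 / (exp 4 * ccb ^ 2))
          (fun m => 64 * (27 : ℝ) ^ 4 * exp 2 * crb / ccb * (exp 4 * ccb ^ 2 * imagTimeWeight β M ^ 2 / 8) ^ m *
            klTowerMuLevF L M β U μ (klFlowFrameU L M β U μ n) 1 1 m) (q + 1) +
        ∑ n' ∈ Icc 2 N, exp 1 * (9 * αb * ccb / ((27 : ℝ) ^ 5 * exp 1 * κb ^ 2 * crb)) ^ (n' - 1) * (exp 4 * ccb ^ 2 / κb ^ 2) ^ (q + 1) *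
          towerS D (exp 2 * κb ^ 2 / ccb ^ 2)
            (fun m => 64 * (27 : ℝ) ^ 4 * exp 2 * crb / ccb * (exp 4 * ccb ^ 2 * imagTimeWeight β M ^ 2 / 8) ^ m *
              klTowerMuLevF L M β U μ (klFlowFrameU L M β U μ n) 1 1 m) n' (q + 1) +
        (exp 4 * ccb ^ 2 / κb ^ 2) ^ (q + 1) * exp 1 *
          towerV D (exp 2 * κb ^ 2 / ccb ^ 2)
            (fun m => 64 * (27 : ℝ) ^ 4 * exp 2 * crb / ccb * (exp 4 * ccb ^ 2 * imagTimeWeight β M ^ 2 / 8) ^ m *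
              klTowerMuLevF L M β U μ (klFlowFrameU L M β U μ n) 1 1 m) *
          (9 * αb * ccb / ((27 : ℝ) ^ 5 * exp 1 * κb ^ 2 * crb) *
            towerV D (exp 2 * κb ^ 2 / ccb ^ 2)
              (fun m => 64 * (27 : ℝ) ^ 4 * exp 2 * crb / ccb * (exp 4 * ccb ^ 2 * imagTimeWeight β M ^ 2 / 8) ^ m *
                klTowerMuLevF L M β U μ (klFlowFrameU L M β U μ n) 1 1 m)) ^ N /
          (1 - 9 * αb * ccb / ((27 : ℝ) ^ 5 * exp 1 * κb ^ 2 * crb) *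
            towerV D (exp 2 * κb ^ 2 / ccb ^ 2)
              (fun m => 64 * (27 : ℝ) ^ 4 * exp 2 * crb / ccb * (exp 4 * ccb ^ 2 * imagTimeWeight β M ^ 2 / 8) ^ m *
                klTowerMuLevF L M β U μ (klFlowFrameU L M β U μ n) 1 1 m)) := by
  obtain ⟨Cκ, Cb, CJ, hCκ, hCb, hCJ, h⟩ := linkDataBlockZeroF_klEng d R c'' hc''
  refine ⟨Cκ, Cb, CJ, hCκ, hCb, hCJ, ?_⟩
  intro G P Q c hP hR2 hc hc6 μ hμ U hU hU9 hcU β hβmin hβc L M _ _ hL3 hM3 n hn1 hnN hreg hhist hfr hosc j hj1 hjd hjn hZ D hD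
    κb αb crb ccb hκb hαb hcrb hccb N hN hguard t q Ωe hΩe
  have he : (0 : ℝ) < klE0 := by norm_num [klE0]
  have hβ : 0 < β := KLRegimeSplit.pos_of_klBetaMin_le hβmin
  have hM0 : (0 : ℝ) < M := Nat.cast_pos.2 (Nat.pos_of_ne_zero (NeZero.ne M))
  obtain ⟨hκ0, hκκb, hGB, hrow, hcol, hαle, hrow', hcol'⟩ :=
    h G P Q c hP hR2 hc hc6 μ hμ U hU hU9 hcU β hβmin hβc L M hL3 hM3 n hn1 hnN hreg hhist hfr hosc j hj1 hjd hjn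
  have hκb0 : 0 < κb := by rw [hκb]; positivity
  have hαb0 : 0 < αb := by rw [hαb]; positivity
  have hcrb0 : 0 < crb := by rw [hcrb]; positivity
  have hccb0 : 0 < ccb := by rw [hccb]; positivity
  subst hκb hαb hcrb hccb
  -- the `1 ≤ dk` partial step at `(d, k) := (1, 1)`: input `𝒱_1` at `F̃_0`, slice `(Λ_j, Λ_1]`; at `j = 1` the overlap pair is `E(F_1)·S(F̃_0)`
  obtain ⟨-, -, -, -, -, -, hrow1, hcol1⟩ :=
    h G P Q c hP hR2 hc hc6 μ hμ U hU hU9 hcU β hβmin hβc L M hL3 hM3 n hn1 hnN hreg hhist hfr hosc 1 le_rfl (hj1.trans hjd) (hj1.trans hjn)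
  exact partialIncrLevF_le_kitStep_of_bounds' (d := 1) (k := 1) hβ U μ _ le_rfl le_rfl (by simpa using hj1) hZ hκ0 hκb0 hκκb hGB hαb0 hαle
    hrow hcol hcrb0 hccb0 hrow1 hcol1 hD hN hguard t q Ωe hΩe


end Summit.HubbardSuperconductivity.HubbardSuperconductivity.Theorems.EngineV8

end
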